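import Summits.BirchSwinnertonDyer.BirchSwinnertonDyer.Theorems.ThetaPartnerAtTwoSignedKatoUpToAtTwoCuspFactorGenerationSupply
import Summits.BirchSwinnertonDyer.BirchSwinnertonDyer.Theorems.ThetaPartnerAtTwoSignedKatoUpToAtTwoCuspFactorEvaluationClause
import Literature.NumberTheory.EllipticCurves.RohrlichNonvanishingProofs
import HarnessLib

/-!
# Route `ThetaPartnerAtTwo` (TP2), crux K3 `SignedKatoDivisibilityUpToAtTwo` (stmt-BirchSwinnertonDyer-20308 / K3P′ 25631), line
# `colemanrat` v13 — brick B1 in the SOCKET'S BINDER SHAPE (`hB1` of the lead's `KatoBK.corePairChiPrim_of_coreKBK_of_bricks`):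
# the four-term cusp element `μ̃ ∉ 𝔭` with Kato's integer data `(c, d, a, A = 2^e, d′, D)` and its values at even characters

Width seat `bsd-wall-tp2-p2x-w3` g7 (cell `bsd-wall`); the lead's B1 ADAPTER REQUEST (bus 2026-08-28T12:21:34Z). HONEST FRAMING: theorems
only (no definition, no named fact, no instance, no `sorry`); a REPACKAGING of width seat w2 g6's brick B1
(`CuspEval.exists_cuspElement_not_mem_of_rohrlich` + `CuspEval.hasSum_cuspElement_character` + the Kato-guard dictionary of
`…CuspFactorKatoGuards`) into the exact binder consumed by the socket; CONDITIONAL on the tree's named fact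
`Rohrlich1984_nonvanishing_twists` (as B1 is); closes no item; K3 / K3P′ are NOT settled and BSD is NOT proved by any of this.

## What

`cuspBrick_of_rohrlich`: granting Rohrlich's theorem, for every normalised newform `f ∈ S₂(Γ₀(N))` with rational coefficients and
`2 ∤ N`, and every height-one prime `𝔭 ∌ 2` of `Λ = ℤ₂⟦T⟧`, there are INTEGERS `c, d, a`, a level `A = 2^{ee}`, `d′` and `D ≠ 0` and
an element `μ̃ ∈ Λ ∖ 𝔭` with Kato's admissibility guards `(c, 6·2·A) = 1`, `(d, 6·2·N) = 1`, `d d′ ≡ 1 (mod A)`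
(`Kato2004.EulerSystemValues.ZetaBody`), such that for every `n` and every EVEN Dirichlet character `χ` modulo `2^{n+2}` of `2`-power
order with values in `ℂ₂`,
`μ̃(χ(5) − 1) = D·(c²d²[a/A]⁻ − cd²·χ(c)·[ac/A]⁻ − c²d·χ(d)·[ad′/A]⁻ + cd·χ(c)χ(d)·[acd′/A]⁻)` (`[x]⁻ = ratMinusSymbol f x`, cast
`ℚ → ℂ₂`; `HasSum` of the coefficientwise evaluation) — `D` times Kato's minus cusp factor `R⁻(χ; c, d, a, A, d′)`
(memo `G7-ASSEMBLY-v1` §0 steps 4–5). Data: w2 g6's `(c, d ∈ ℕ, a ∈ (ℤ/2^e)ˣ, db, D, t)` with `Qc = 3`, `Qd = 3N`, `η = 1`, read as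
`c, d ↦ ↑c, ↑d`, `a ↦ a.val`, `d′ ↦ (db⁻¹).val`, `D ↦ ↑D`.

References: K. Kato, Astérisque 295 (2004) Thm. 12.6, §13.12, Ex. 13.3 [Kato2004Asterisque]; D. Rohrlich, Invent. Math. 75 (1984)
[RohrlichInventiones1984].
-/

set_option autoImplicit false
-- the Theorems namespace of this sub repeats the summit name by design (D-0017 nested layout)
set_option linter.dupNamespace false

noncomputable section

open scoped BigOperators

open CongruenceSubgroup Literature.NumberTheory.EllipticCurves Literature.NumberTheory.EllipticCurves.ModularForms
  Literature.NumberTheory.EllipticCurves.CyclotomicZp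

namespace Summit.BirchSwinnertonDyer.BirchSwinnertonDyer.Theorems.SignedKatoOffTwo.KatoBK

/-- **Brick B1 in the socket's binder shape** (`hB1` of `KatoBK.corePairChiPrim_of_coreKBK_of_bricks`). Granting
`Rohrlich1984_nonvanishing_twists`: for a normalised newform `f` of odd level `N` with rational coefficients and a height-one prime
`𝔭 ∌ 2` of `ℤ₂⟦T⟧`, there are `c d a : ℤ`, `ee : ℕ`, `d' D : ℤ`, `μ̃ : Λ` with `(c, 6·2·2^{ee}) = 1`, `(d, 6·2·N) = 1`,
`d·d' ≡ 1 (mod 2^{ee})`, `D ≠ 0`, `μ̃ ∉ 𝔭`, and for all `n` and all even `2`-power-order `χ` mod `2^{n+2}` (values in `ℂ₂`) the series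
`∑ ι(coeff_k μ̃)(χ(5) − 1)^k` converges to `D·(c²d²[a/2^{ee}]⁻ − cd²χ(c)[ac/2^{ee}]⁻ − c²dχ(d)[ad'/2^{ee}]⁻ + cdχ(c)χ(d)[acd'/2^{ee}]⁻)`.
Repackaging of `CuspEval.exists_cuspElement_not_mem_of_rohrlich` (`Qc = 3`, `Qd = 3N`, `η = 1`), `CuspEval.hasSum_cuspElement_character`
and the guard dictionary of `…CuspFactorKatoGuards`. [cite: Kato2004Asterisque, Thm. 12.6 (p. 222), §13.12 (pp. 231–233), Ex. 13.3 (p. 225)]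
[cite: RohrlichInventiones1984, Theorem (p. 409)] -/
theorem cuspBrick_of_rohrlich (hR : Rohrlich1984_nonvanishing_twists) :
    ∀ {N : ℕ} [NeZero N] (f : CuspForm (Gamma0 N) 2), IsNewform0 f → coeffField f = ⊥ → ¬ 2 ∣ N →
    ∀ 𝔭 : PrimeSpectrum (IwasawaAlgebra 2), 𝔭.asIdeal.height = 1 → PowerSeries.C (2 : ℤ_[2]) ∉ 𝔭.asIdeal →
    ∃ (c d a : ℤ) (ee : ℕ) (d' D : ℤ) (μt : IwasawaAlgebra 2),
      Int.gcd c (6 * 2 * 2 ^ ee) = 1 ∧ Int.gcd d (6 * 2 * N) = 1 ∧ d * d' ≡ 1 [ZMOD ((2 ^ ee : ℕ) : ℤ)] ∧ D ≠ 0 ∧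
      μt ∉ 𝔭.asIdeal ∧
      ∀ (n : ℕ) (χ : DirichletCharacter ℂ_[2] (2 ^ (n + 2))), χ.Even → (∃ j : ℕ, orderOf χ = 2 ^ j) →
        HasSum (fun k ↦ ((algebraMap ℚ_[2] ℂ_[2]).comp (algebraMap ℤ_[2] ℚ_[2])) (PowerSeries.coeff k μt) *
            (χ (5 : ZMod (2 ^ (n + 2))) - 1) ^ k)
          ((D : ℂ_[2]) * ((c : ℂ_[2]) ^ 2 * (d : ℂ_[2]) ^ 2 * ((ratMinusSymbol f ((a : ℚ) / (2 ^ ee : ℕ)) : ℚ) : ℂ_[2])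
            - (c : ℂ_[2]) * (d : ℂ_[2]) ^ 2 * χ (c : ZMod (2 ^ (n + 2))) *
                ((ratMinusSymbol f ((a * c : ℚ) / (2 ^ ee : ℕ)) : ℚ) : ℂ_[2])
            - (c : ℂ_[2]) ^ 2 * (d : ℂ_[2]) * χ (d : ZMod (2 ^ (n + 2))) *
                ((ratMinusSymbol f ((a * d' : ℚ) / (2 ^ ee : ℕ)) : ℚ) : ℂ_[2])
            + (c : ℂ_[2]) * (d : ℂ_[2]) * (χ (c : ZMod (2 ^ (n + 2))) * χ (d : ZMod (2 ^ (n + 2)))) *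
                ((ratMinusSymbol f ((a * c * d' : ℚ) / (2 ^ ee : ℕ)) : ℚ) : ℂ_[2]))) := by
  intro N _ f hf hQ h2N 𝔭 h𝔭 h2
  have hQd : Nat.Coprime 2 (3 * N) :=
    Nat.Coprime.mul_right (by norm_num) ((Nat.Prime.coprime_iff_not_dvd Nat.prime_two).mpr h2N)
  obtain ⟨e, -, -, a, D, t, hD, ht, c, d, uc, ud, cb, db, huc, hud, hcb, hdb, hcQ, hdQ, hmem⟩ :=
    CuspEval.exists_cuspElement_not_mem_of_rohrlich hR hf hQ h2N (Qc := 3) (Qd := 3 * N) (by norm_num) (by norm_num) hQd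
      1 𝔭 h𝔭 h2 0
  haveI : NeZero (2 ^ e) := ⟨pow_ne_zero _ two_ne_zero⟩
  simp only [one_mul] at hmem
  obtain ⟨hc2, hc3⟩ := CuspEval.coprime_two_and_of_coprime_two_mul hcQ
  have hdb' : ((d : ℤ) : ZMod (2 ^ e)) = db := by rw [Int.cast_natCast]; exact hdb.symm
  refine ⟨(c : ℤ), (d : ℤ), (((a : ZMod (2 ^ e)).val : ℤ)), e, ((((db⁻¹ : (ZMod (2 ^ e))ˣ) : ZMod (2 ^ e)).val : ℤ)), (D : ℤ), _,
    CuspEval.int_gcd_eq_one_of_coprime_two_three hc2 hc3 e, CuspEval.int_gcd_eq_one_of_coprime_two_mul hdQ,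
    CuspEval.intCast_mul_inv_val_modEq_one db d hdb', by exact_mod_cast hD.ne', hmem, fun n χ hev hord ↦ ?_⟩
  have h := CuspEval.hasSum_cuspElement_character f a cb db c d uc ud huc hud hcb D t ht χ hev hord
  rw [show (cyclotomicGenerator 2 : ℕ) = 5 from rfl] at h
  simp only [Nat.cast_ofNat] at h
  convert h using 1
  push_cast
  ring

/-! ## §2 The ROHRLICH-FREE twin for the newform of an elliptic curve

The chain of brick B1 uses the named fact `Rohrlich1984_nonvanishing_twists` only through its `P = {2}` case
(`Rohrlich1984_nonvanishing_twists.primePow … (p := 2)`: finitely many primitive `χ` of `2`-power conductor have `L(f, χ, 1) = 0`), and for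
the newform of an ELLIPTIC CURVE that case is a TREE THEOREM (`Rohrlich1984_nonvanishing_twists.primePow_of_isNewformOf`). The theorems
below re-run w2 g6's chain (`OddTwistSupply.exists_three_odd_isPrimitive_ratMinusTwistedSymbolSum_ne_zero` →
`…exists_three_unitHom_sum_ratMinusSymbol_ne_zero` → `CuspEval.exists_cuspElement_not_mem_of_rohrlich`) with that finiteness as an explicit
hypothesis `hfin` instead of `hR` (proof bodies verbatim otherwise), and conclude the socket binder `hB1` UNCONDITIONALLY for `IsNewformOf W f`. -/

section RohrlichFree

variable {N : ℕ} [NeZero N] {f : CuspForm (Gamma0 N) 2}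

/-- **The odd-twist supply at `2` from the finiteness of vanishing `2`-power twists** (w2 g6's
`OddTwistSupply.exists_three_odd_isPrimitive_ratMinusTwistedSymbolSum_ne_zero` with Rohrlich's `P = {2}` conclusion as the hypothesis
`hfin`): for every `e₀` there are `e ≥ e₀`, `e ≥ 3`, and three distinct odd primitive `ψ` modulo `2^e` with `ratMinusTwistedSymbolSum f ψ ≠ 0`.
[cite: RohrlichInventiones1984, Theorem (p. 409)] [cite: Kato2004Asterisque, Thm. 13.5 (2) (p. 227), §13.12 (pp. 231–233)] -/
theorem exists_three_odd_isPrimitive_ratMinusTwistedSymbolSum_ne_zero_of_finite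
    (hfin : Set.Finite {χ : Σ m : ℕ, DirichletCharacter ℂ m |
      χ.1 ≠ 0 ∧ χ.1.primeFactors ⊆ {2} ∧ χ.2.IsPrimitive ∧
        ∃ L : ℂ → ℂ, Differentiable ℂ L ∧ (∀ s : ℂ, 2 < s.re → L s = twistedLSeries f χ.2 s) ∧ L 1 = 0})
    (hf : IsNewform0 f) (hQ : coeffField f = ⊥) (e₀ : ℕ) :
    ∃ e : ℕ, e₀ ≤ e ∧ 3 ≤ e ∧ ∃ ψ : Fin 3 → DirichletCharacter ℂ (2 ^ e),
      Function.Injective ψ ∧ ∀ i, (ψ i).Odd ∧ (ψ i).IsPrimitive ∧ ratMinusTwistedSymbolSum f (ψ i) ≠ 0 := by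
  classical
  set Bad := hfin.toFinset with hBad
  set C := Bad.card with hC
  -- the level
  set e := e₀ + C + 6 with he
  have he3 : 3 ≤ e := by omega
  have hpow : C + 3 ≤ 2 ^ (e - 3) := by
    have h1 : e - 3 = e₀ + C + 3 := by omega
    rw [h1]
    calc C + 3 ≤ e₀ + C + 3 := by omega
      _ ≤ 2 ^ (e₀ + C + 3) := Nat.lt_two_pow_self.le
  haveI : NeZero (2 ^ e) := ⟨pow_ne_zero _ two_ne_zero⟩
  obtain ⟨ψ, hψinj, hψ⟩ := OddTwistSupply.exists_odd_isPrimitive_family ℂ he3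
  -- the failing indices inject into the finite set
  let F : Finset (Fin (2 ^ (e - 3))) := Finset.univ.filter fun j ↦ ratMinusTwistedSymbolSum f (ψ j) = 0
  have hFinj : Set.InjOn (fun j : Fin (2 ^ (e - 3)) ↦ (⟨2 ^ e, (ψ j)⁻¹⟩ : Σ m : ℕ, DirichletCharacter ℂ m)) F := by
    intro j _ j' _ hjj'
    simp only [Sigma.mk.injEq, heq_eq_eq, true_and] at hjj'
    exact hψinj (inv_injective hjj')
  have hFmaps : ∀ j ∈ F, (⟨2 ^ e, (ψ j)⁻¹⟩ : Σ m : ℕ, DirichletCharacter ℂ m) ∈ Bad := by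
    intro j hj
    rw [Finset.mem_filter] at hj
    rw [hBad, Set.Finite.mem_toFinset]
    refine ⟨pow_ne_zero _ two_ne_zero, ?_, ?_, ?_⟩
    · rw [Nat.primeFactors_prime_pow (by omega) Nat.prime_two]
    · show ((ψ j)⁻¹).IsPrimitive
      rw [DirichletCharacter.isPrimitive_def, DirichletCharacter.conductor_inv]
      exact (hψ j).2
    · obtain ⟨L, hL, hL'⟩ := exists_differentiable_eq_twistedLSeries_holds f (ψ j)⁻¹
      exact ⟨L, hL, hL',
        OddTwistSupply.twistedL_one_eq_zero_of_ratMinusTwistedSymbolSum_eq_zero hf hQ (hψ j).2 (hψ j).1 hj.2 hL hL'⟩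
  have hFcard : F.card ≤ C := by
    rw [hC]
    exact Finset.card_le_card_of_injOn _ hFmaps hFinj
  -- hence at least three good indices
  let Good : Finset (Fin (2 ^ (e - 3))) := Finset.univ.filter fun j ↦ ratMinusTwistedSymbolSum f (ψ j) ≠ 0
  have hGood : 3 ≤ Good.card := by
    have hsplit : F.card + Good.card = 2 ^ (e - 3) := by
      have h := Finset.card_filter_add_card_filter_not (s := (Finset.univ : Finset (Fin (2 ^ (e - 3)))))
        (fun j ↦ ratMinusTwistedSymbolSum f (ψ j) = 0)
      rw [Finset.card_univ, Fintype.card_fin] at h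
      exact h
    omega
  obtain ⟨t, ht, htcard⟩ := Finset.exists_subset_card_eq hGood
  let ε : Fin 3 ≃ {x // x ∈ t} := (t.equivFinOfCardEq htcard).symm
  refine ⟨e, by omega, he3, fun k ↦ ψ (ε k), ?_, fun k ↦ ⟨(hψ _).1, (hψ _).2, ?_⟩⟩
  · intro k k' hkk'
    exact ε.injective (Subtype.ext (hψinj hkk'))
  · have hmem : ((ε k : {x // x ∈ t}) : Fin (2 ^ (e - 3))) ∈ Good := ht (ε k).2
    rw [Finset.mem_filter] at hmem
    exact hmem.2

/-- **The supply in the currency of the span lemma, from the finiteness hypothesis** (w2 g6's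
`OddTwistSupply.exists_three_unitHom_sum_ratMinusSymbol_ne_zero` with `hfin` for `hR`): three distinct `ψ_i : (ℤ/2^e)^× →* ℂ` with
`∑_b ψ_i(b)·[b/2^e]⁻_f ≠ 0`. [cite: RohrlichInventiones1984, Theorem (p. 409)] [cite: Kato2004Asterisque, §13.12 (pp. 231–233)] -/
theorem exists_three_unitHom_sum_ratMinusSymbol_ne_zero_of_finite
    (hfin : Set.Finite {χ : Σ m : ℕ, DirichletCharacter ℂ m |
      χ.1 ≠ 0 ∧ χ.1.primeFactors ⊆ {2} ∧ χ.2.IsPrimitive ∧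
        ∃ L : ℂ → ℂ, Differentiable ℂ L ∧ (∀ s : ℂ, 2 < s.re → L s = twistedLSeries f χ.2 s) ∧ L 1 = 0})
    (hf : IsNewform0 f) (hQ : coeffField f = ⊥) (e₀ : ℕ) :
    ∃ e : ℕ, e₀ ≤ e ∧ 3 ≤ e ∧ ∃ ψ : Fin 3 → ((ZMod (2 ^ e))ˣ →* ℂ),
      Function.Injective ψ ∧
        ∀ i, ∑ b : (ZMod (2 ^ e))ˣ, ψ i b * ((ratMinusSymbol f (((b : ZMod (2 ^ e)).val : ℚ) / 2 ^ e) : ℚ) : ℂ) ≠ 0 := by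
  classical
  obtain ⟨e, hee, he3, ψ, hψinj, hψ⟩ :=
    exists_three_odd_isPrimitive_ratMinusTwistedSymbolSum_ne_zero_of_finite hfin hf hQ e₀
  haveI : NeZero (2 ^ e) := ⟨pow_ne_zero _ two_ne_zero⟩
  refine ⟨e, hee, he3, fun i ↦ (Units.coeHom ℂ).comp (ψ i).toUnitHom, ?_, fun i ↦ ?_⟩
  · intro i i' h
    apply hψinj
    apply MulChar.ext'
    intro a
    by_cases ha : IsUnit a
    · obtain ⟨b, rfl⟩ := ha
      have := DFunLike.congr_fun h b
      simpa only [MonoidHom.coe_comp, Function.comp_apply, Units.coeHom_apply, MulChar.coe_toUnitHom] using this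
    · rw [MulChar.map_nonunit _ ha, MulChar.map_nonunit _ ha]
  · have hsum : ∑ b : (ZMod (2 ^ e))ˣ, ((Units.coeHom ℂ).comp (ψ i).toUnitHom) b *
        ((ratMinusSymbol f (((b : ZMod (2 ^ e)).val : ℚ) / 2 ^ e) : ℚ) : ℂ) = ratMinusTwistedSymbolSum f (ψ i) := by
      rw [ratMinusTwistedSymbolSum]
      simp only [MonoidHom.coe_comp, Function.comp_apply, Units.coeHom_apply, MulChar.coe_toUnitHom, Nat.cast_pow,
        Nat.cast_ofNat]
      -- non-units contribute zero
      rw [← Finset.sum_subset (Finset.subset_univ ((Finset.univ : Finset (ZMod (2 ^ e))).filter IsUnit))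
        (fun a _ ha ↦ by
          rw [Finset.mem_filter, not_and] at ha
          rw [MulChar.map_nonunit _ (ha (Finset.mem_univ a)), zero_mul])]
      refine (Finset.sum_bij (fun (b : (ZMod (2 ^ e))ˣ) _ ↦ (b : ZMod (2 ^ e))) (fun b _ ↦ by simp) (fun b _ b' _ h ↦ Units.ext h)
        (fun a ha ↦ ?_) (fun b _ ↦ rfl))
      rw [Finset.mem_filter] at ha
      obtain ⟨b, rfl⟩ := ha.2
      exact ⟨b, Finset.mem_univ _, rfl⟩
    rw [hsum]
    exact (hψ i).2.2

/-- **Cusp-factor generation from the finiteness hypothesis** (w2 g6's `CuspEval.exists_cuspElement_not_mem_of_rohrlich` with `hfin` for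
`hR`; same data: `e ≥ max(e₀, 3)`, cusp class `a`, scaling `D ≥ 1`, `t(b) = D·[ab/2^e]⁻_f ∈ ℤ`, admissible `c, d`, the four-term element
outside `𝔭`). [cite: Kato2004Asterisque, Thm. 12.6 (p. 222), §13.12 (pp. 231–233)] [cite: RohrlichInventiones1984, Theorem (p. 409)] -/
theorem exists_cuspElement_not_mem_of_finite
    (hfin : Set.Finite {χ : Σ m : ℕ, DirichletCharacter ℂ m |
      χ.1 ≠ 0 ∧ χ.1.primeFactors ⊆ {2} ∧ χ.2.IsPrimitive ∧
        ∃ L : ℂ → ℂ, Differentiable ℂ L ∧ (∀ s : ℂ, 2 < s.re → L s = twistedLSeries f χ.2 s) ∧ L 1 = 0})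
    (hf : IsNewform0 f) (hQf : coeffField f = ⊥)
    {Qc Qd : ℕ} (hQc2 : Nat.Coprime 2 Qc) (hQc5 : Nat.Coprime 5 Qc) (hQd : Nat.Coprime 2 Qd) (η : ℤ_[2])
    (𝔭 : PrimeSpectrum (IwasawaAlgebra 2)) (h𝔭 : 𝔭.asIdeal.height = 1) (h2 : PowerSeries.C (2 : ℤ_[2]) ∉ 𝔭.asIdeal) (e₀ : ℕ) :
    ∃ e : ℕ, e₀ ≤ e ∧ 3 ≤ e ∧ ∃ (a : (ZMod (2 ^ e))ˣ) (D : ℕ) (t : (ZMod (2 ^ e))ˣ → ℤ), 0 < D ∧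
      (∀ b : (ZMod (2 ^ e))ˣ, (t b : ℚ) = D * ratMinusSymbol f ((((a * b : (ZMod (2 ^ e))ˣ) : ZMod (2 ^ e)).val : ℚ) / 2 ^ e)) ∧
      ∃ (c d : ℕ) (uc ud : ℤ_[2]ˣ) (cb db : (ZMod (2 ^ e))ˣ),
        (uc : ℤ_[2]) = c ∧ (ud : ℤ_[2]) = d ∧ (cb : ZMod (2 ^ e)) = c ∧ (db : ZMod (2 ^ e)) = d ∧
        Nat.Coprime c (2 * Qc) ∧ Nat.Coprime d (2 * Qd) ∧
        PowerSeries.C ((c ^ 2 * d ^ 2 * t 1 : ℤ) : ℤ_[2])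
            - PowerSeries.C ((c * d ^ 2 * t cb : ℤ) : ℤ_[2]) * PowerSeries.binomialSeries ℤ_[2] (η * ell 2 uc)
            - PowerSeries.C ((c ^ 2 * d * t db⁻¹ : ℤ) : ℤ_[2]) * PowerSeries.binomialSeries ℤ_[2] (η * ell 2 ud)
            + PowerSeries.C ((c * d * t (cb * db⁻¹) : ℤ) : ℤ_[2]) * PowerSeries.binomialSeries ℤ_[2] (η * ell 2 uc) *
                PowerSeries.binomialSeries ℤ_[2] (η * ell 2 ud) ∉ 𝔭.asIdeal := by
  classical
  obtain ⟨e, hee, he3, ψ, hψ, hψne⟩ := exists_three_unitHom_sum_ratMinusSymbol_ne_zero_of_finite hfin hf hQf e₀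
  haveI : NeZero (2 ^ e) := ⟨pow_ne_zero _ two_ne_zero⟩
  -- the untranslated symbol function and a non-vanishing cusp `a`
  set s₁ : (ZMod (2 ^ e))ˣ → ℚ := fun b ↦ ratMinusSymbol f (((b : ZMod (2 ^ e)).val : ℚ) / 2 ^ e) with hs₁
  have hψne' : ∀ i, ∑ b : (ZMod (2 ^ e))ˣ, ψ i b * ((s₁ b : ℚ) : ℂ) ≠ 0 := fun i ↦ by
    simpa only [hs₁] using hψne i
  obtain ⟨a, ha⟩ : ∃ a : (ZMod (2 ^ e))ˣ, s₁ a ≠ 0 := by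
    by_contra h
    push Not at h
    exact hψne' 0 (Finset.sum_eq_zero fun b _ ↦ by rw [h b, Rat.cast_zero, mul_zero])
  -- translate by `a` and clear denominators
  set s : (ZMod (2 ^ e))ˣ → ℚ := fun b ↦ s₁ (a * b) with hs
  obtain ⟨D, t, hD, ht⟩ := CuspEval.exists_int_eq_mul s
  have ht1 : t 1 ≠ 0 := by
    intro h0
    have := ht 1
    rw [h0, Int.cast_zero, hs] at this
    simp only [mul_one] at this
    exact mul_ne_zero (by exact_mod_cast hD.ne') ha this.symm
  have hval : ∀ i x, ψ i x ≠ 0 := fun i x hx ↦ by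
    have := map_mul (ψ i) x x⁻¹
    rw [mul_inv_cancel, map_one, hx, zero_mul] at this
    exact one_ne_zero this
  have htne : ∀ i, ∑ b : (ZMod (2 ^ e))ˣ, ψ i b * (t b : ℂ) ≠ 0 := by
    intro i h0
    apply hψne' i
    have hre : ∑ b : (ZMod (2 ^ e))ˣ, ψ i b * (t b : ℂ) =
        (D : ℂ) * (ψ i a)⁻¹ * ∑ b : (ZMod (2 ^ e))ˣ, ψ i b * ((s₁ b : ℚ) : ℂ) := by
      rw [Finset.mul_sum]
      refine (Fintype.sum_equiv (Equiv.mulLeft a) _ _ fun b ↦ ?_)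
      simp only [Equiv.coe_mulLeft, map_mul]
      have htb : (t b : ℂ) = (D : ℂ) * ((s₁ (a * b) : ℚ) : ℂ) := by
        have h := congrArg (fun q : ℚ ↦ (q : ℂ)) (ht b)
        simp only [hs, Rat.cast_intCast, Rat.cast_mul, Rat.cast_natCast] at h
        exact h
      rw [htb]
      have hinv : (ψ i a)⁻¹ * ψ i a = 1 := inv_mul_cancel₀ (hval i a)
      linear_combination (-((D : ℂ) * ψ i b * ((s₁ (a * b) : ℚ) : ℂ))) * hinv
    rw [hre] at h0
    rcases mul_eq_zero.mp h0 with h1 | h1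
    · rcases mul_eq_zero.mp h1 with h2' | h2'
      · exact absurd h2' (by exact_mod_cast hD.ne')
      · exact absurd h2' (inv_ne_zero (hval i a))
    · exact h1
  obtain ⟨c, d, uc, ud, cb, db, h1, h2', h3, h4, h5, h6, hmem⟩ :=
    CuspEval.exists_cuspElement_not_mem he3 t ht1 ψ hψ htne hQc2 hQc5 hQd η 𝔭 h𝔭 h2
  refine ⟨e, hee, he3, a, D, t, hD, fun b ↦ by rw [ht b], c, d, uc, ud, cb, db, h1, h2', h3, h4, h5, h6, hmem⟩

/-- **Brick B1 in the socket's binder shape, from the finiteness hypothesis** (`cuspBrick_of_rohrlich` with `hfin` for `hR`).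
[cite: Kato2004Asterisque, Thm. 12.6 (p. 222), §13.12 (pp. 231–233), Ex. 13.3 (p. 225)] [cite: RohrlichInventiones1984, Theorem (p. 409)] -/
theorem cuspBrick_of_finite
    (hfin : Set.Finite {χ : Σ m : ℕ, DirichletCharacter ℂ m |
      χ.1 ≠ 0 ∧ χ.1.primeFactors ⊆ {2} ∧ χ.2.IsPrimitive ∧
        ∃ L : ℂ → ℂ, Differentiable ℂ L ∧ (∀ s : ℂ, 2 < s.re → L s = twistedLSeries f χ.2 s) ∧ L 1 = 0})
    (hf : IsNewform0 f) (hQ : coeffField f = ⊥) (h2N : ¬ 2 ∣ N)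
    (𝔭 : PrimeSpectrum (IwasawaAlgebra 2)) (h𝔭 : 𝔭.asIdeal.height = 1) (h2 : PowerSeries.C (2 : ℤ_[2]) ∉ 𝔭.asIdeal) :
    ∃ (c d a : ℤ) (ee : ℕ) (d' D : ℤ) (μt : IwasawaAlgebra 2),
      Int.gcd c (6 * 2 * 2 ^ ee) = 1 ∧ Int.gcd d (6 * 2 * N) = 1 ∧ d * d' ≡ 1 [ZMOD ((2 ^ ee : ℕ) : ℤ)] ∧ D ≠ 0 ∧
      μt ∉ 𝔭.asIdeal ∧
      ∀ (n : ℕ) (χ : DirichletCharacter ℂ_[2] (2 ^ (n + 2))), χ.Even → (∃ j : ℕ, orderOf χ = 2 ^ j) →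
        HasSum (fun k ↦ ((algebraMap ℚ_[2] ℂ_[2]).comp (algebraMap ℤ_[2] ℚ_[2])) (PowerSeries.coeff k μt) *
            (χ (5 : ZMod (2 ^ (n + 2))) - 1) ^ k)
          ((D : ℂ_[2]) * ((c : ℂ_[2]) ^ 2 * (d : ℂ_[2]) ^ 2 * ((ratMinusSymbol f ((a : ℚ) / (2 ^ ee : ℕ)) : ℚ) : ℂ_[2])
            - (c : ℂ_[2]) * (d : ℂ_[2]) ^ 2 * χ (c : ZMod (2 ^ (n + 2))) *
                ((ratMinusSymbol f ((a * c : ℚ) / (2 ^ ee : ℕ)) : ℚ) : ℂ_[2])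
            - (c : ℂ_[2]) ^ 2 * (d : ℂ_[2]) * χ (d : ZMod (2 ^ (n + 2))) *
                ((ratMinusSymbol f ((a * d' : ℚ) / (2 ^ ee : ℕ)) : ℚ) : ℂ_[2])
            + (c : ℂ_[2]) * (d : ℂ_[2]) * (χ (c : ZMod (2 ^ (n + 2))) * χ (d : ZMod (2 ^ (n + 2)))) *
                ((ratMinusSymbol f ((a * c * d' : ℚ) / (2 ^ ee : ℕ)) : ℚ) : ℂ_[2]))) := by
  have hQd : Nat.Coprime 2 (3 * N) :=
    Nat.Coprime.mul_right (by norm_num) ((Nat.Prime.coprime_iff_not_dvd Nat.prime_two).mpr h2N)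
  obtain ⟨e, -, -, a, D, t, hD, ht, c, d, uc, ud, cb, db, huc, hud, hcb, hdb, hcQ, hdQ, hmem⟩ :=
    exists_cuspElement_not_mem_of_finite hfin hf hQ (Qc := 3) (Qd := 3 * N) (by norm_num) (by norm_num) hQd 1 𝔭 h𝔭 h2 0
  haveI : NeZero (2 ^ e) := ⟨pow_ne_zero _ two_ne_zero⟩
  simp only [one_mul] at hmem
  obtain ⟨hc2, hc3⟩ := CuspEval.coprime_two_and_of_coprime_two_mul hcQ
  have hdb' : ((d : ℤ) : ZMod (2 ^ e)) = db := by rw [Int.cast_natCast]; exact hdb.symm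
  refine ⟨(c : ℤ), (d : ℤ), (((a : ZMod (2 ^ e)).val : ℤ)), e, ((((db⁻¹ : (ZMod (2 ^ e))ˣ) : ZMod (2 ^ e)).val : ℤ)), (D : ℤ), _,
    CuspEval.int_gcd_eq_one_of_coprime_two_three hc2 hc3 e, CuspEval.int_gcd_eq_one_of_coprime_two_mul hdQ,
    CuspEval.intCast_mul_inv_val_modEq_one db d hdb', by exact_mod_cast hD.ne', hmem, fun n χ hev hord ↦ ?_⟩
  have h := CuspEval.hasSum_cuspElement_character f a cb db c d uc ud huc hud hcb D t ht χ hev hord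
  rw [show (cyclotomicGenerator 2 : ℕ) = 5 from rfl] at h
  simp only [Nat.cast_ofNat] at h
  convert h using 1
  push_cast
  ring

/-- **Brick B1 in the socket's binder shape, UNCONDITIONALLY for the newform of an elliptic curve.** For `E = W/ℚ` with newform `f` of odd
level `N` (`IsNewformOf W f`, `2 ∤ N`) and every height-one prime `𝔭 ∌ 2` of `ℤ₂⟦T⟧`: the conclusion of `cuspBrick_of_rohrlich` for this
`f`, WITHOUT the named fact — Rohrlich's theorem for `P = {2}` is the tree theorem
`Rohrlich1984_nonvanishing_twists.primePow_of_isNewformOf`. [cite: RohrlichInventiones1984, Theorem (p. 409)]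
[cite: Kato2004Asterisque, Thm. 12.6 (p. 222), §13.12 (pp. 231–233), Ex. 13.3 (p. 225)] -/
theorem cuspBrick_of_isNewformOf {W : WeierstrassCurve ℚ} [W.IsElliptic] (hfW : IsNewformOf W f) (h2N : ¬ 2 ∣ N)
    (𝔭 : PrimeSpectrum (IwasawaAlgebra 2)) (h𝔭 : 𝔭.asIdeal.height = 1) (h2 : PowerSeries.C (2 : ℤ_[2]) ∉ 𝔭.asIdeal) :
    ∃ (c d a : ℤ) (ee : ℕ) (d' D : ℤ) (μt : IwasawaAlgebra 2),
      Int.gcd c (6 * 2 * 2 ^ ee) = 1 ∧ Int.gcd d (6 * 2 * N) = 1 ∧ d * d' ≡ 1 [ZMOD ((2 ^ ee : ℕ) : ℤ)] ∧ D ≠ 0 ∧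
      μt ∉ 𝔭.asIdeal ∧
      ∀ (n : ℕ) (χ : DirichletCharacter ℂ_[2] (2 ^ (n + 2))), χ.Even → (∃ j : ℕ, orderOf χ = 2 ^ j) →
        HasSum (fun k ↦ ((algebraMap ℚ_[2] ℂ_[2]).comp (algebraMap ℤ_[2] ℚ_[2])) (PowerSeries.coeff k μt) *
            (χ (5 : ZMod (2 ^ (n + 2))) - 1) ^ k)
          ((D : ℂ_[2]) * ((c : ℂ_[2]) ^ 2 * (d : ℂ_[2]) ^ 2 * ((ratMinusSymbol f ((a : ℚ) / (2 ^ ee : ℕ)) : ℚ) : ℂ_[2])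
            - (c : ℂ_[2]) * (d : ℂ_[2]) ^ 2 * χ (c : ZMod (2 ^ (n + 2))) *
                ((ratMinusSymbol f ((a * c : ℚ) / (2 ^ ee : ℕ)) : ℚ) : ℂ_[2])
            - (c : ℂ_[2]) ^ 2 * (d : ℂ_[2]) * χ (d : ZMod (2 ^ (n + 2))) *
                ((ratMinusSymbol f ((a * d' : ℚ) / (2 ^ ee : ℕ)) : ℚ) : ℂ_[2])
            + (c : ℂ_[2]) * (d : ℂ_[2]) * (χ (c : ZMod (2 ^ (n + 2))) * χ (d : ZMod (2 ^ (n + 2)))) *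
                ((ratMinusSymbol f ((a * c * d' : ℚ) / (2 ^ ee : ℕ)) : ℚ) : ℂ_[2]))) :=
  cuspBrick_of_finite (Rohrlich1984_nonvanishing_twists.primePow_of_isNewformOf hfW h2N) hfW.1 hfW.coeffField_eq_bot h2N 𝔭 h𝔭 h2

end RohrlichFree

end Summit.BirchSwinnertonDyer.BirchSwinnertonDyer.Theorems.SignedKatoOffTwo.KatoBK

end
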